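import Summits.BirchSwinnertonDyer.BirchSwinnertonDyer.Theorems.ClassRecordThreeEulerHalvesAtThreeHybridInertShape
import Summits.BirchSwinnertonDyer.BirchSwinnertonDyer.Theorems.ClassRecordThreeEulerHalvesAtThreePoitouTateOfCanonical
import Summits.BirchSwinnertonDyer.BirchSwinnertonDyer.Theorems.ClassRecordThreeEulerHalvesAtThreeTwistLowerOfX11a
import Summits.BirchSwinnertonDyer.BirchSwinnertonDyer.Theorems.ClassRecordThreeKolyvaginShaOrderDivisibleEnd
import Summits.BirchSwinnertonDyer.BirchSwinnertonDyer.Theorems.ClassRecordThreeEulerHalvesAtThreeInertDisplayOfPrimitives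
import Summits.BirchSwinnertonDyer.BirchSwinnertonDyer.Theorems.ClassRecordThreeEulerHalvesAtThreeNotRamInertServableCutNormalForm
import Summits.BirchSwinnertonDyer.BirchSwinnertonDyer.Theorems.ClassRecordThreeEulerHalvesAtThreeShimuraInertSavingDisplayOfE0Prime
import Summits.BirchSwinnertonDyer.BirchSwinnertonDyer.Theorems.ClassRecordThreeEulerHalvesAtThreeShimuraAuxNormE0Prime
import Summits.BirchSwinnertonDyer.BirchSwinnertonDyer.Theorems.ClassRecordThreeEulerHalvesAtThreeAuxInertLevelOfChebotarev
import Summits.BirchSwinnertonDyer.BirchSwinnertonDyer.Theorems.ClassRecordThreeEulerHalvesAtThreeAuxInertLevelAtThree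
import Summits.BirchSwinnertonDyer.BirchSwinnertonDyer.Theorems.ClassRecordThreeEulerHalvesAtThreeCarrierLocalE0AtThree
import Summits.BirchSwinnertonDyer.BirchSwinnertonDyer.Theorems.ClassRecordThreeCornerAtThreeMilneTamagawaHolds
import Summits.BirchSwinnertonDyer.BirchSwinnertonDyer.Theorems.SchneiderFreeAdditiveX3PoitouTateReciprocitySumHolds
import Summits.BirchSwinnertonDyer.BirchSwinnertonDyer.Theorems.SemiOrdinaryEisensteinDescentShaTwoCochainShell
import Summits.BirchSwinnertonDyer.BirchSwinnertonDyer.Theorems.SemiOrdinaryEisensteinDescentShaTwoCochainBridgeAssemblyCriterion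
import Summits.BirchSwinnertonDyer.BirchSwinnertonDyer.Theorems.SemiOrdinaryEisensteinDescentShaTwoCochainClassReadout
import Literature.NumberTheory.EllipticCurves.HeegnerPointsIdentityComponentProofs
import Summits.BirchSwinnertonDyer.BirchSwinnertonDyer.Theorems.ClassRecordThreeEulerHalvesAtThreeCoStepLDefs
import Summits.BirchSwinnertonDyer.BirchSwinnertonDyer.Theorems.ClassRecordThreeEulerHalvesAtThreeOfItemsR21
import Summits.BirchSwinnertonDyer.BirchSwinnertonDyer.Theorems.ClassRecordThreeEulerHalvesAtThreeExtraRoadCutComposition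
import Literature.NumberTheory.GaloisCohomology.PoitouTateFiniteShaDualityHolds
import Literature.NumberTheory.EllipticCurves.QuadraticTwistLocalDataAtTwoHoldsProofs
import Summits.BirchSwinnertonDyer.BirchSwinnertonDyer.Theorems.ClassRecordThreeEulerHalvesAtThreeShimuraItemsOfCartanItems
import HarnessLib

/-!
# BC3 skeleton `Lines/inert.lean` — r28 CANDIDATE (bsd-idea-10 g27, transfer; = banked r27b + the two `C = ∅` transports, per LEAD tam3-p1 g33 07:55:31Z ∕ pen g49 07:54:55Z): the Shimura-curve print binders (items 19524, 23177) REPLACED by the Cartan-road print binders (items 23754, 23828) they follow from — ZERO stubs, SEVEN route items BY NAME, NINE bundle conjuncts used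

r28 = r27b (below; = keyed r27 960a206bf18c321a + bundle conjunct 13 served by its tree `_holds`) with ONE more change: the binders
`hSh : Theses.ClassRecordThree.ShimuraParametrizationDataNonempty` (item 19524, Jacquet–Langlands + Shimura: parametrisation data by `X₀^D(M)`) and
`hPrim : Theses.ClassRecordThree.ShimuraPrimitivesAtThreeInertFact` (item 23177, Heegner-system primitives of `X_{N⁺,N⁻}` at the inert prime `3`) now read
`hSh : Theses.ClassRecordThree.CartanParametrizationDataNonemptyFact` (item 23754 = (F3) of line `cartan`) and
`hPrim : Theses.ClassRecordThree.CartanHeegnerPrimitivesAtThreeFact` (item 23828 = (F1) of line `cartan`), and their two uses are served through the tree theorems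
`EulerHalvesCartanShadow.classRecordThree_shimuraParametrizationDataNonempty_of_cartanFact : 23754 → 19524` and
`EulerHalvesCartanShadow.classRecordThree_shimuraPrimitivesAtThreeInertFact_of_cartanFact : 23828 → 23177`
(`Theorems/ClassRecordThreeEulerHalvesAtThreeShimuraItemsOfCartanItems.lean`, p765879: the Eichler-level facts are the `C = ∅` shadows of the Cartan-level ones, via
tam3-p1's transport `cartanOfShimura` ∕ `cpdOfSpd` ∕ `spdOfCpd`). WHY: the cone of crux 19109 owes (F3) and (F1) ANYWAY through its seventh binder (the residue item
`EulerHalvesAtThreeResidualUpperBound`, line `cartan` v15, binders `hF3` ∕ `hF1`), so binding 23754 ∕ 23828 here makes the print input 23177 leave every cone of 19109 and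
19524 leave the inert cone (19524 leaves every cone once the residue line serves its own `hSh` from `hF3` — hunk v15b), with NO new dependency and nothing weakened
((F3) ⟹ 19524 and (F1) ⟹ 23177 are theorems; the converses are not claimed). CAVEAT (LEAD g33): the inert road in isolation then carries the slightly more general
Cartan-level (F3) ∕ (F1) instead of the Eichler-level 19524 ∕ 23177 — r27b stays banked as the fallback should the Cartan road ever leave 19109's cone.
`EulerHalvesAtThree_of` binds EXACTLY SEVEN route decls BY NAME {19112, 27981, 23754, 19716, 23828, 23178, `EulerHalvesAtThreeResidualUpperBound`}; `_of'` = the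
`KolyvaginRoadThree` twin over KR3's own decls; proof body otherwise byte-identical to r27b. Candidate only: keyed by the route pen if and when it chooses (W-79);
nothing closes; BSD is proved for no curve. (r27b header follows.)

# r27b (bsd-idea-10 g26, transfer; banked, farm rc 0, b8e75ef49673dfb1): r26 with the Poitou–Tate binder `hPT2` (item 23176) DISCHARGED and bundle conjunct 13 (Barrios et al.) served by its tree `_holds` — ZERO stubs, SEVEN route items BY NAME, NINE bundle conjuncts used

r27 = r26 with ONE change: the binder `hPT2 : Theses.ClassRecordThree.PoitouTateShaTateDualFact` (route item stmt-BirchSwinnertonDyer-23176, aside r9 —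
Poitou–Tate duality `Ш¹(K, M^D)` ∕ `Ш²(K, M)` for finite modules, Milne ADT I Thm. 4.10 (a)) is DELETED and its use is served by the Literature THEOREM
`Literature.NumberTheory.GaloisCohomology.poitouTate_sha_tateDual_holds` (`Literature/NumberTheory/GaloisCohomology/PoitouTateFiniteShaDualityHolds.lean`;
the same statement is closed `proved` as item 20462 on the sibling route `UniversalToricDescent`, and item 23176's two route decls are proved BY NAME in
`Theorems/ClassRecordThreeEulerHalvesAtThreePoitouTateShaTateDualFactByName.lean`, p764832). `EulerHalvesAtThree_of` now binds EXACTLY SEVEN route decls BY NAME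
{19112, 27981, 19524, 19716, 23177, 23178, `EulerHalvesAtThreeResidualUpperBound`}; and r27b additionally serves conjunct 13 of `PublishedInputsThree` (`BarriosEtAl2025.localTamagawaNumber_quadraticTwist_two_mem_of_goodReduction`, the old pattern `hBR`) by the Literature theorem `…_holds` (`Literature/NumberTheory/EllipticCurves/QuadraticTwistLocalDataAtTwoHoldsProofs.lean`), so the line's GENUINE print dependence on the bundle is NINE of its twenty conjuncts {1 GZ, 2 Kolyvagin, 4 Skinner C, 6 GZK, 7 entire L, 8 newform, 9 Hoffstein–Luo, 10 Mazur–Manin, 12 Friedberg–Hoffstein} (count-neutral: 19112 stays one item); proof body otherwise byte-identical to r26. Candidate only: keyed by the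
route pen if and when it chooses (W-79); nothing else moves. (r26 header follows.)

r26 = r25 with `stub_residualUpperBoundAtThree` turned into the ROUTE ITEM it became under RULING 78 (plan g43, 2026-08-28T20:29Z: placement (α)
upheld): `Theses.ClassRecordThree.EulerHalvesAtThreeResidualUpperBound := Theorems.EulerHalvesAtThreeResidualUpperBound` (Defs p665127) BY NAME =
    (Z)  ∀ W, ClassX11b W 3 → Surj W 3 → MultiCarrierAt W → ResidualNormalFormAt W → Typed.MissingUpperBoundAt W 3,
the MISSING UPPER BOUND on the residual Tamagawa class — WEAKER than the IMC-form item 23334 (which now feeds (Z) through line `costepl`, zero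
stubs) and the common target of every road on the residue (line `cartan`: bsd-idea-10's non-split Cartan road, kernel p662140). `EulerHalvesAtThree_of`
binds EXACTLY the eight route decls BY NAME {19112 `PublishedInputsThree`, 27981 `EulerHalfGrossPrintFacts`, 19524 `ShimuraParametrizationDataNonempty`,
19716 `PastenComponentOrdersInput`, 23176 `PoitouTateShaTateDualFact`, 23177 `ShimuraPrimitivesAtThreeInertFact`, 23178 `X11aLowerHalfAtThree`,
`EulerHalvesAtThreeResidualUpperBound`} and nothing else (`_of'` = the `KolyvaginRoadThree` twin). Proof = closers p665485 §4
(`EulerHalvesResidualUB.eulerHalvesAtThree_of_items_of_residualUpperBound`, inlined): the road-agnostic composition p658732 at `Φ := residual class`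
(`hRoad` := the item, `hcoRes` VACUOUS) over the r20–r24 chain (McCallum Cor. 5.6 upper half, Jetchev MAX walk, inert ORDER display, E′-road SAVED
display, TL₃; kernel theorems for the Cassels–Tate level inputs, the Selmer-structure duality, Milne I.3.8, carrierLocalE0, chebotarevSupply,
auxiliaryInertLevel). 0 `sorry`. History r1–r25: `HOME/tam3-p1/g1*/`. Nothing is asserted about any curve (T7); BSD is proved for no curve.
-/



set_option linter.dupNamespace false
set_option autoImplicit false

noncomputable section

open scoped Classical NumberField Pointwise

namespace Summit.BirchSwinnertonDyer.BirchSwinnertonDyer.Cruxes.EulerHalvesAtThree.Inert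

open WeierstrassCurve IsDedekindDomain NumberField Field Literature.NumberTheory.EllipticCurves
  Literature.NumberTheory.EllipticCurves.ModularForms Literature.NumberTheory.EllipticCurves.Jetchev2008
  Literature.NumberTheory.EllipticCurves.KolyvaginCocycle
  Literature.NumberTheory.EllipticCurves.Rank1Residual Literature.NumberTheory.GaloisRepresentations
  Literature.NumberTheory.GaloisRepresentations.DiscreteGaloisModule
  Literature.NumberTheory.GaloisCohomology Literature.NumberTheory.Automorphic
  Literature.NumberTheory.EllipticCurves.BarriosEtAl2025 CongruenceSubgroup
  Summit.BirchSwinnertonDyer.Rank1Residual Summit.BirchSwinnertonDyer.Rank1Residual.X11b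
  Summit.BirchSwinnertonDyer.Rank1Residual.X11b.Three Summit.BirchSwinnertonDyer.Rank1Residual.X11b.Three.Koly
  Summit.BirchSwinnertonDyer.Rank1Residual.JET
  Literature.NumberTheory.EllipticCurves.Rank1Residual.Typed Literature.NumberTheory.QuadraticFields.Quadratic
  Summit.BirchSwinnertonDyer.Rank1Residual.X11b.AcSelmer
  Summit.BirchSwinnertonDyer.BirchSwinnertonDyer.Theorems

/-- **Crux 19109 `EulerHalvesAtThree` BY NAME from its SEVEN route items BY NAME — r28 candidate (r27b with the Shimura print binders 19524 ∕ 23177 replaced by the Cartan print binders 23754 ∕ 23828, served through `EulerHalvesCartanShadow.…_of_cartanFact`), zero stubs** (see the module docstring for the ledger of inputs). The chain is the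
registered line's: McCallum Cor. 5.6 upper half (`…_of_casselsTate_of_frobeniusCongruence_of_E0`), Jetchev's MAX walk at `3 ∥ N`
(`Koly.jetchevMaxHLAtThree_of_swapLiterature`), the inert ORDER display (`Koly.inertDisplayAtThree_of_primitivesAtThreeInert_of_casselsTateLevelInputs`),
the inert SAVED display on the E′-label road (`ShimuraWalk.inertSavingDisplayAtThreeD_of_primitives_of_E0Prime_of_milne_of_poitouTate_of_casselsTate`
at `Φ := Surj · 3` over `e0PrimeSupplyAtThree`), TL₃ from crux 19064 read at `3` (`Koly.twistLowerAtThree_of_thmC_of_x11aLowerHalfAtThree`), and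
tam3-p1 g17's r16 composition `classRecordThree_eulerHalvesAtThree_of_jetchevMaxHL_of_displaysD_of_notRamServableDF_of_coStepLResidualNormalForm_of_twistLower`.
CONDITIONAL on the seven items; nothing booked.
[cite: McCallumLMS1991, §5 Cor. 5.6 (p. 310)] [cite: Jetchev2008, Thm. 1.4 (p. 812)] [cite: GrossLMS1991, Prop. 3.7 (2), §6]
[cite: PastenShimura2024, Prop. 5.1, §6.6] [cite: Skinner2016PacificMC, Thm. C (§1)] [cite: Harari2020, Thm. 17.13 (b)] -/
theorem EulerHalvesAtThree_of
    (h : Summit.BirchSwinnertonDyer.BirchSwinnertonDyer.Theses.ClassRecordThree.PublishedInputsThree)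
    (hF : Summit.BirchSwinnertonDyer.BirchSwinnertonDyer.Theses.ClassRecordThree.EulerHalfGrossPrintFacts)
    (hSh : Summit.BirchSwinnertonDyer.BirchSwinnertonDyer.Theses.ClassRecordThree.CartanParametrizationDataNonemptyFact)
    (hCO : Summit.BirchSwinnertonDyer.BirchSwinnertonDyer.Theses.ClassRecordThree.PastenComponentOrdersInput)
    (hPrim : Summit.BirchSwinnertonDyer.BirchSwinnertonDyer.Theses.ClassRecordThree.CartanHeegnerPrimitivesAtThreeFact)
    (hX : Summit.BirchSwinnertonDyer.BirchSwinnertonDyer.Theses.ClassRecordThree.X11aLowerHalfAtThree)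
    -- the residue crux (RULING 78, placement (α)): `:= Theorems.EulerHalvesAtThreeResidualUpperBound` BY NAME
    (hZ : Summit.BirchSwinnertonDyer.BirchSwinnertonDyer.Theses.ClassRecordThree.EulerHalvesAtThreeResidualUpperBound) :
    Summit.BirchSwinnertonDyer.BirchSwinnertonDyer.Theses.ClassRecordThree.EulerHalvesAtThree := by
  have hF1 : Gross1991_heegnerPoint_sub_ratTorsion_mem_E0 := Gross1991_heegnerPoint_sub_ratTorsion_mem_E0_of_imageFree hF.2
  -- the Cassels–Tate level inputs: cell bsd-wall's Ш²-cochain bridge (the proof term of item 20191's closer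
  -- `ShaTwoCochainTheta.casselsTate_levelInputs_of_shaTwoCochainBridge`, restated over its three route-independent modules)
  have hCT : ∀ (K : Type) [Field K] [NumberField K], casselsTate_levelInputs K := fun K _ _ ↦
    ShaTwoCochainTheta.casselsTate_levelInputs_of_readout_vanishing_flip K
      (ShaTwoCochainTheta.hbridge_of_readout_criterion K
        (ShaTwoCochain.classBarInv_readout_eq_zero_of_criterion K))
  have hPT : ∀ (K : Type) [Field K] [NumberField K], poitouTate_selmerStructure_duality_conj K :=
    poitouTate_conj_forall_of_selmerComplement_canonical fun K _ _ n _ ↦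
      Summit.BirchSwinnertonDyer.BirchSwinnertonDyer.Theorems.SchneiderFreeAdditiveX3.PoitouTateReduction.selmerComplement_canonical_holds
        K n
  have hM38 : Milne2006_localTamagawaNumber_smul_unramifiedClass_eq_zero.{0} :=
    MilneTamagawa.Milne2006_localTamagawaNumber_smul_unramifiedClass_eq_zero_holds
  have hX3 : ∀ (V : WeierstrassCurve ℚ) [V.IsElliptic] [V.IsGloballyMinimal],
      Summit.BirchSwinnertonDyer.Rank1Residual.ClassX11a V 3 →
        Literature.NumberTheory.EllipticCurves.Rank1Residual.Typed.MissingLowerBoundAt V 3 := hX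
  obtain ⟨hGZ, hKo, -, hSk, -, hGZK, hmod, hnf, hHL, hMaz, -, hFH, -, -, -, -, -, -, -, -⟩ := h
  -- conjunct 13 of the bundle (Barrios et al. 2025 Thm. 5.1, `c₂` of quadratic twists at good `2`) is a TREE THEOREM — served by its `_holds`:
  have hBR := Literature.NumberTheory.EllipticCurves.BarriosEtAl2025.localTamagawaNumber_quadraticTwist_two_mem_of_goodReduction_holds
  -- items 19524 ∕ 23177 (Eichler-level Shimura-curve print facts) SERVED from items 23754 ∕ 23828 (their Cartan-level parents at `C = ∅`, p765879)
  have hSh' : Summit.BirchSwinnertonDyer.BirchSwinnertonDyer.Theses.ClassRecordThree.ShimuraParametrizationDataNonempty :=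
    EulerHalvesCartanShadow.classRecordThree_shimuraParametrizationDataNonempty_of_cartanFact hSh
  have hPrim' : Summit.BirchSwinnertonDyer.BirchSwinnertonDyer.Theses.ClassRecordThree.ShimuraPrimitivesAtThreeInertFact :=
    EulerHalvesCartanShadow.classRecordThree_shimuraPrimitivesAtThreeInertFact_of_cartanFact hPrim
  have hMcU : McCallum1991_padicValNat_card_sha_primary_add_le_of_globalDivisibility :=
    McCallum1991_padicValNat_card_sha_primary_add_le_of_globalDivisibility_of_casselsTate_of_frobeniusCongruence_of_E0 hCT hF.1 hF1
  have hJ := jetchevMaxHLAtThree_of_swapLiterature hF.1 hGZ hmod hPT hF1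
  have hDisp := inertDisplayAtThree_of_primitivesAtThreeInert_of_casselsTateLevelInputs hCT hPrim'
  have hSav := ShimuraWalk.inertSavingDisplayAtThreeD_of_primitives_of_E0Prime_of_milne_of_poitouTate_of_casselsTate
    (fun V ↦ Surj V 3) (fun _ _ _ _ hsurj ↦ hsurj) hCT hPrim' hM38 hPT EulerHalvesInertR21.e0PrimeSupplyAtThree
  have hTL := Summit.BirchSwinnertonDyer.Rank1Residual.X11b.Three.Koly.twistLowerAtThree_of_thmC_of_x11aLowerHalfAtThree
    hmod hGZK hSk hX3
  exact EulerHalvesExtraRoad.classRecordThree_eulerHalvesAtThree_of_inertRoads_of_extraRoad_of_coStepLResidualOffRoad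
    hGZ hKo hSk hGZK hmod hnf hHL hMaz (fun N _ W K _ _ ↦ heegnerPointOfConductor_one_galoisConj_holds N W K)
    (fun N _ W K _ _ ↦ phi_heegnerTau_mem_singularModuliField_holds N W K) hMcU
    (fun K _ _ ↦ poitouTate_selmerStructure_duality_of_conj (hPT K))
    (fun K _ _ ↦ Literature.NumberTheory.GaloisCohomology.poitouTate_sha_tateDual_holds K) hFH hBR
    hSh' hCO hJ hDisp hTL hSav hX3
    -- the extra road := the residual class itself, served by the residue item; the off-road residue is then VACUOUS
    (fun W _ _ ↦ MultiCarrierAt W ∧ ResidualNormalFormAt W)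
    (fun W _ _ hXW hρ hΦ ↦ hZ W hXW hρ hΦ.1 hΦ.2)
    (fun W _ _ hm hnΦ hr ↦ (hnΦ ⟨hm, hr⟩).elim)

/-- **The `KolyvaginRoadThree` twin** (same statement; binders = KR3's own decls of items 27981 ∕ 23754 ∕ 19716 ∕ 23828 ∕ 23178 ∕ the residue item,
shared by id, and CR3's 19112 as in r10–r20). [cite: McCallumLMS1991, §5 Cor. 5.6 (p. 310)] [cite: Jetchev2008, Thm. 1.4 (p. 812)] -/
theorem EulerHalvesAtThree_of'
    (h : Summit.BirchSwinnertonDyer.BirchSwinnertonDyer.Theses.ClassRecordThree.PublishedInputsThree)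
    (hF : Summit.BirchSwinnertonDyer.BirchSwinnertonDyer.Theses.KolyvaginRoadThree.EulerHalfGrossPrintFacts)
    (hSh : Summit.BirchSwinnertonDyer.BirchSwinnertonDyer.Theses.KolyvaginRoadThree.CartanParametrizationDataNonemptyFact)
    (hCO : Summit.BirchSwinnertonDyer.BirchSwinnertonDyer.Theses.KolyvaginRoadThree.PastenComponentOrdersInput)
    (hPrim : Summit.BirchSwinnertonDyer.BirchSwinnertonDyer.Theses.KolyvaginRoadThree.CartanHeegnerPrimitivesAtThreeFact)
    (hX : Summit.BirchSwinnertonDyer.BirchSwinnertonDyer.Theses.KolyvaginRoadThree.X11aLowerHalfAtThree)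
    (hZ : Summit.BirchSwinnertonDyer.BirchSwinnertonDyer.Theses.KolyvaginRoadThree.EulerHalvesAtThreeResidualUpperBound) :
    Summit.BirchSwinnertonDyer.BirchSwinnertonDyer.Theses.KolyvaginRoadThree.EulerHalvesAtThree :=
  EulerHalvesAtThree_of h hF hSh hCO hPrim hX hZ

end Summit.BirchSwinnertonDyer.BirchSwinnertonDyer.Cruxes.EulerHalvesAtThree.Inert

end
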